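import Summits.ValiantsHypothesis.ValiantsHypothesis.Theorems.BarrierLeverSigmaPiSigmaSliceFormalDegree
import Summits.ValiantsHypothesis.ValiantsHypothesis.Theorems.BarrierLeverROABPSliceEquations
import Summits.ValiantsHypothesis.ValiantsHypothesis.Theorems.BarrierLeverFormulaSliceEquations

/-!
# Route BarrierLever — the MODEL axis of crux `DefinableEquations` (stmt-ValiantsHypothesis-8745) /
# item `SingleSizeEquations` (8749): capstone — ONE distinguisher, ONE level, against the UNION of
# the classical slices

The model-axis files prove the crux's sentence (`∃ a ∀ b ∃ n₀ ∀ n ≥ n₀`, a nonzero level-`a`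
distinguisher vanishing on the class) separately for the diagonal depth-3 slice
(`SigmaLambdaSigmaSlice`, Sylvester / Nisan–Wigderson), the homogeneous and the bounded-formal-degree
depth-3 slices (`SigmaPiSigmaSlice`, Nisan–Wigderson 1996), read-once oblivious ABPs of every order
(`ROABPSlice`, Nisan 1991) and — at fixed quadratic size — fan-in-two formulas (`FormulaSlice`,
Kalorkoti 1985).  Natural proofs compose under unions of classes by taking products of
certificates (`IsNaturalProof.mul_union`: the coefficient ring is a domain, sizes and degrees add),
so ONE level-`21` distinguisher `classicalCert n = slsCert · spsCert · nisanCert · formulaCert`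
vanishes, for every `b` and all `n ≥ 162 · 16^b`, on the UNION `classicalSlices n (n^b)` of all
five classes: `naturalProofsAgainstClassicalModels`, boolean-sum form `classicalSlicesEquations`.
This is the honest chart of what the tree's FSV framework provably captures at `poly(N)` cost with
a level independent of the size exponent — every classical rank-type lower-bound method — while the
crux itself (general circuits of size `n^b`, `b ≥ 2`) remains Chatterjee–Tengse 2023 §1.3 dir. 2,
open.
WHAT THIS IS NOT: nothing on general circuits, 8746, 14610 or VP vs VNP.
-/

-- layout Summits/ValiantsHypothesis/ValiantsHypothesis forces the duplicated namespace component
set_option linter.dupNamespace false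

noncomputable section

open MvPolynomial Finsupp

namespace Summit.ValiantsHypothesis.ValiantsHypothesis.Theorems.BarrierLever.ModelAxis

open Literature.Computability.AlgebraicComplexity Literature.Barriers.ValiantsHypothesis
open SigmaLambdaSigmaSlice SigmaPiSigmaSlice ROABPSlice FormulaSlice

/-! ## Natural proofs compose under unions of classes -/

section union

variable {n : ℕ}

/-- `3 ≤ N = C(2n,n)` for `n ≥ 2`. [folklore] -/
theorem three_le_centralBinom (hn : 2 ≤ n) : 3 ≤ (2 * n).choose n := by
  have h4 : 4 ≤ 2 ^ n := by
    calc (4 : ℕ) = 2 ^ 2 := by norm_num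
      _ ≤ 2 ^ n := Nat.pow_le_pow_right (by norm_num) hn
  have := Literature.ModelTheory.FiniteModelTheory.two_pow_le_choose_two_mul_self n
  omega

/-- **Natural proofs compose under unions**: if `D₁` is a level-`a₁` natural proof against `𝒞₁` and
`D₂` a level-`a₂` natural proof against `𝒞₂` (same coefficient space, `n ≥ 2`), then `D₁ · D₂` is a
level-`(max a₁ a₂ + 1)` natural proof against `𝒞₁ ∪ 𝒞₂` (the coefficient ring is a domain; sizes and
degrees add). [cite: ForbesShpilkaVolk2018, Def. 1] -/
theorem _root_.Literature.Barriers.ValiantsHypothesis.IsNaturalProof.mul_union (hn : 2 ≤ n)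
    {𝒞₁ 𝒞₂ : Set (MvPolynomial (Fin n) ℂ)} {a₁ a₂ : ℕ} {D₁ D₂ : MvPolynomial (degLEMonomials n) ℂ}
    (h₁ : IsNaturalProof (degLEMonomials n) 𝒞₁ (Distinguishers ℂ n a₁) D₁)
    (h₂ : IsNaturalProof (degLEMonomials n) 𝒞₂ (Distinguishers ℂ n a₂) D₂) :
    IsNaturalProof (degLEMonomials n) (𝒞₁ ∪ 𝒞₂) (Distinguishers ℂ n (max a₁ a₂ + 1)) (D₁ * D₂) := by
  obtain ⟨⟨hc₁, hd₁⟩, hne₁, hv₁⟩ := h₁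
  obtain ⟨⟨hc₂, hd₂⟩, hne₂, hv₂⟩ := h₂
  set N := (2 * n).choose n with hNdef
  have hN3 : 3 ≤ N := three_le_centralBinom hn
  have hm₁ : N ^ a₁ ≤ N ^ max a₁ a₂ := Nat.pow_le_pow_right (by omega) (le_max_left _ _)
  have hm₂ : N ^ a₂ ≤ N ^ max a₁ a₂ := Nat.pow_le_pow_right (by omega) (le_max_right _ _)
  have hone : 1 ≤ N ^ max a₁ a₂ := Nat.one_le_pow _ _ (by omega)
  refine ⟨⟨?_, ?_⟩, mul_ne_zero hne₁ hne₂, ?_⟩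
  · calc complexity (D₁ * D₂) ≤ complexity D₁ + complexity D₂ + 1 := complexity_mul_le_holds _ _
      _ ≤ N ^ max a₁ a₂ + N ^ max a₁ a₂ + N ^ max a₁ a₂ :=
          Nat.add_le_add (Nat.add_le_add (hc₁.trans hm₁) (hc₂.trans hm₂)) hone
      _ = 3 * N ^ max a₁ a₂ := by ring
      _ ≤ N * N ^ max a₁ a₂ := Nat.mul_le_mul_right _ hN3
      _ = N ^ (max a₁ a₂ + 1) := by ring
  · calc (D₁ * D₂).totalDegree ≤ D₁.totalDegree + D₂.totalDegree := totalDegree_mul _ _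
      _ ≤ N ^ max a₁ a₂ + N ^ max a₁ a₂ := Nat.add_le_add (hd₁.trans hm₁) (hd₂.trans hm₂)
      _ = 2 * N ^ max a₁ a₂ := by ring
      _ ≤ N * N ^ max a₁ a₂ := Nat.mul_le_mul_right _ (by omega)
      _ = N ^ (max a₁ a₂ + 1) := by ring
  · rintro f (hf | hf)
    · rw [map_mul, hv₁ f hf, zero_mul]
    · rw [map_mul, hv₂ f hf, mul_zero]

/-- A natural proof against `𝒞₁` that also vanishes on `𝒞₂` is a natural proof against `𝒞₁ ∪ 𝒞₂`
(same certificate, same level). [cite: ForbesShpilkaVolk2018, Def. 1] -/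
theorem _root_.Literature.Barriers.ValiantsHypothesis.IsNaturalProof.union_of_vanishes
    {𝒞₁ 𝒞₂ : Set (MvPolynomial (Fin n) ℂ)} {𝒟 : Set (MvPolynomial (degLEMonomials n) ℂ)}
    {D : MvPolynomial (degLEMonomials n) ℂ} (h₁ : IsNaturalProof (degLEMonomials n) 𝒞₁ 𝒟 D)
    (h₂ : ∀ f ∈ 𝒞₂, eval (coeffVector (degLEMonomials n) f) D = 0) :
    IsNaturalProof (degLEMonomials n) (𝒞₁ ∪ 𝒞₂) 𝒟 D :=
  ⟨h₁.1, h₁.2.1, fun f hf => hf.elim (h₁.2.2 f) (h₂ f)⟩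

end union

/-! ## The union of the classical slices and the product certificate -/

section slices

variable (n : ℕ)

/-- **The union of the classical slices** at size parameter `s`: sums of `≤ s` powers of affine
forms (`ΣΛΣ`), sums of `≤ s` products of linear forms (homogeneous `ΣΠΣ`), sums of `≤ s` products of
`≤ 2⌊n/9⌋` affine forms (bounded-formal-degree `ΣΠΣ`), width-`s` ROABPs in any variable order, and
(independently of `s`) fan-in-two formulas of size `≤ n²/20` — all of degree `≤ n`. [folklore] -/
def classicalSlices (s : ℕ) : Set (MvPolynomial (Fin n) ℂ) :=
  (((sigmaLambdaSigmaSlice n s ∪ (sigmaPiSigmaSlice n s ∪ sigmaPiSigmaLowDegSlice n s)) ∪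
    roabpSlice n s) ∪ {f | f.totalDegree ≤ n ∧ formulaComplexity f ≤ n * n / 20})

/-- **The product certificate**: `slsCert · spsCert · nisanCert · formulaCert`. [folklore] -/
def classicalCert : MvPolynomial (degLEMonomials n) ℂ :=
  slsCert n * spsCert n * nisanCert n * formulaCert n

variable {n}

/-- The threshold of the capstone dominates the four individual thresholds. [folklore] -/
theorem thresholds_of_le {b : ℕ} (hn : 162 * 16 ^ b ≤ n) :
    2 * 4 ^ (b + 2) ≤ n ∧ 10 ≤ n ∧ 2 ≤ n := by
  have h16 : 4 ^ b ≤ 16 ^ b := Nat.pow_le_pow_left (by norm_num) b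
  have h1 : 1 ≤ 4 ^ b := Nat.one_le_pow _ _ (by norm_num)
  have h4 : 2 * 4 ^ (b + 2) = 32 * 4 ^ b := by ring
  omega

/-- **The product certificate is a level-21 natural proof against the union of the classical
slices** at size `n^b`, for `n ≥ 162 · 16^b`. [cite: ForbesShpilkaVolk2018, Def. 1] -/
theorem isNaturalProof_classicalCert {b : ℕ} (hn : 162 * 16 ^ b ≤ n) :
    IsNaturalProof (degLEMonomials n) (classicalSlices n (n ^ b)) (Distinguishers ℂ n 21)
      (classicalCert n) := by
  obtain ⟨h4, h10, h2⟩ := thresholds_of_le hn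
  have hn1 : 1 ≤ n := by omega
  -- ΣΛΣ at level 18
  have hsls := isNaturalProof_slsCert (n := n) hn1 (pow_mul_succ_lt_two_pow_half h4)
  -- homogeneous ΣΠΣ and bounded-formal-degree ΣΠΣ: the same certificate, level 18
  have hsps : IsNaturalProof (degLEMonomials n)
      (sigmaPiSigmaSlice n (n ^ b) ∪ sigmaPiSigmaLowDegSlice n (n ^ b)) (Distinguishers ℂ n 18)
      (spsCert n) :=
    (isNaturalProof_spsCert hn1 (pow_mul_centralBinom_lt_choose hn)).union_of_vanishes
      fun f hf => eval_spsCert_eq_zero_of_mem_lowDeg (pow_mul_centralBinom_lt_choose hn) hf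
  -- ROABPs at level 19, formulas at level 12
  have hro := isNaturalProof_nisanCert (n := n) hn1 (ROABPSlice.pow_lt_two_pow_half h4)
  have hfo := isNaturalProof_formulaCert (n := n) (four_mul_sq_div_twenty_succ_lt h10)
  have h := ((hsls.mul_union h2 hsps).mul_union h2 hro).mul_union h2 hfo
  exact h

end slices

/-- **HEADLINE (model axis, capstone) — ONE distinguisher, ONE level, every size exponent, all
classical slices at once.**  There is a level `a` (`= 21`) such that for EVERY `b`, for all
`n ≥ 162 · 16^b`, the union of the classical slices at size `n^b` — `ΣΛΣ` (Waring), homogeneous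
`ΣΠΣ`, `ΣΠΣ` of formal degree `≤ 2⌊n/9⌋`, ROABPs of width `n^b` in any variable order, and fan-in-two
formulas of size `≤ n²/20` — is NOT a succinct hitting set for `Distinguishers ℂ n a`: the sentence
of `DefinableEquations` with `SmallCircuits ℂ n b` replaced by `classicalSlices n (n^b)`.
[cite: ForbesShpilkaVolk2018, Def. 1 and Thm. 4] -/
theorem naturalProofsAgainstClassicalModels : ∃ a : ℕ, ∀ b : ℕ, ∃ n₀ : ℕ, ∀ n ≥ n₀,
    ¬ IsSuccinctHittingSet (degLEMonomials n) (classicalSlices n (n ^ b)) (Distinguishers ℂ n a) :=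
  ⟨21, fun b => ⟨162 * 16 ^ b, fun _ hn =>
    (exists_isNaturalProof_iff _ _ _).mp ⟨_, isNaturalProof_classicalCert hn⟩⟩⟩

/-- **The 8745-shaped statement on the union of the classical slices** (boolean-sum form,
`q = 0`). [cite: ForbesShpilkaVolk2018, Def. 1 and Thm. 4] -/
theorem classicalSlicesEquations : ∃ a : ℕ, ∀ b : ℕ, ∃ n₀ : ℕ, ∀ n ≥ n₀,
    ∃ q : ℕ, q ≤ (Nat.choose (2 * n) n) ^ a ∧
      ∃ H : MvPolynomial (↥(degLEMonomials n) ⊕ Fin q) ℂ,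
        complexity H ≤ (Nat.choose (2 * n) n) ^ a ∧ H.totalDegree ≤ (Nat.choose (2 * n) n) ^ a ∧
        boolSum H ≠ 0 ∧
        ∀ f ∈ classicalSlices n (n ^ b), eval (coeffVector (degLEMonomials n) f) (boolSum H) = 0 := by
  refine ⟨21, fun b => ⟨162 * 16 ^ b, fun n hn =>
    ⟨0, Nat.zero_le _, MvPolynomial.rename Sum.inl (classicalCert n), ?_⟩⟩⟩
  obtain ⟨hD, hne, hvan⟩ := isNaturalProof_classicalCert hn
  obtain ⟨hc, hdeg, hsum⟩ := SingleSizeEquations.distinguisher_isBoolSum hD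
  refine ⟨hc, hdeg, by rwa [hsum], fun f hf => ?_⟩
  rw [hsum]
  exact hvan f hf

end Summit.ValiantsHypothesis.ValiantsHypothesis.Theorems.BarrierLever.ModelAxis

end
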